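import Summits.ValiantsHypothesis.ValiantsHypothesis.Theorems.BarrierLeverChowHitsPartitionMinorsRFacePrivatePrelims

/-!
# Route BarrierLever — item `ChowHitsPartitionMinorsR` (stmt-ValiantsHypothesis-21882):
# the EXACT GADGET CALCULUS — partition-coefficient congruences and the factorisations of the
# x-gadget groups and of the y-single pair forms into units × rank-one tensors

Helper file (`--supports stmt-ValiantsHypothesis-21882`; cell valiant-natproofs, rung V4, 𝒟-side support item of
route BarrierLever; prover seat val-np-p5 gen 30; seat memo MEMO-21882-valnp5-g30.md §5). Closes NO item.

WHY. The two-sided designs of the memo (bi-star, «x-star + y-single forms») are analysed through a UNIT REDUCTION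
in `A_R ⊗ A_C`: each group of affine forms equals, modulo monomials with a squared variable (which no partition
coefficient sees), a product of PURE units (pure-`x` or pure-`y` polynomials with constant term `1`, whose effect on
partition matrices of lower-set layouts is unitriangular — `ChowFacePrivate.det_partitionMatrix_pureX_mul_ne_zero_iff`,
p714053) and ONE rank-one tensor factor. This file provides that calculus at the level of polynomials:

* `PCongr f g` — «`f` and `g` have the same partition coefficients» (equality modulo the span of monomials with a
  squared variable); an equivalence relation, stable under sums and PRODUCTS (`PCongr.mul`, from the convolution
  formula `BiadditiveDoor.coeff_partitionExpo_mul`), and it identifies partition matrices (`PCongr.matrix_eq`);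
* `coeff_partitionExpo_X_mul_X_mul` — a monomial with a squared variable is invisible; `coeff_partitionExpo_monomial`;
* **x-GADGET** `pcongr_xGadget`: for `|T| = n ≥ 1`, a primitive `n`-th root of unity `ζ` and a scalar `s`,
  `∏_{k<n} (1 + x_a + ζ^k s Y_T) ≡ (1 + c·y^T) · (1 + n·x_a) · (1 − n c · x_a y^T)`, `c = −(−s)^n n!`
  (FP's root-group identity `ChowFacePrivate.coeff_partitionExpo_rootGroup` with `σ = {a}`): a pure-`y` unit, a
  pure-`x` unit, and the rank-one factor `1 + γ x_a ⊗ y^T`;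
* **PAIR FORM** `pcongr_pairForm`: `1 + λ x_a + λ x_{a'} + κ y_c ≡ (1 + λ x_a + λ x_{a'}) · (1 + κ y_c) · (1 − κ·χ·y_c)`
  with `χ = λ x_a + λ x_{a'} − 2λ² x_a x_{a'}` (`a ≠ a'`): the factor `1 − κ χ ⊗ y_c` of the y-single pair forms.

These are the identities (G1), (G2) of the memo's THEOREM for the crossing family 𝓑_h; the row formula (G3) and the
triangular assembly are the sequel. Definition in this file: `PCongr` only.

WHAT THIS IS NOT: item 21882 is NOT proved; nothing on crux stmt-ValiantsHypothesis-14610 or on `VP` versus `VNP`.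
-/

set_option linter.dupNamespace false

namespace Summit.ValiantsHypothesis.ValiantsHypothesis.Theorems.BarrierLever.ChowExactGadgets

open Finset MvPolynomial
open Summit.ValiantsHypothesis.ValiantsHypothesis.Theorems.BarrierLever.ProductStateSums
  (castAdd_ne_natAdd partitionExpo_apply_castAdd partitionExpo_apply_natAdd)
open Summit.ValiantsHypothesis.ValiantsHypothesis.Theorems.BarrierLever.BiadditiveDoor
  (coeff_partitionExpo_mul)
open Summit.ValiantsHypothesis.ValiantsHypothesis.Theorems.BarrierLever.CorankRepair
  (partitionExpo_eq_iff)
open Summit.ValiantsHypothesis.ValiantsHypothesis.Theorems.BarrierLever.ChowFactor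
  (coeff_partitionExpo_one)
open Summit.ValiantsHypothesis.ValiantsHypothesis.Theorems.BarrierLever.ChowFacePrivate
  (coeff_partitionExpo_rootGroup)

noncomputable section

variable {h : ℕ} {K : Type*} [CommRing K]

/-! ## 1. Partition-coefficient congruence -/

/-- **`PCongr f g`: `f` and `g` have the same partition coefficients** — the same coefficient at every
square-free «partition» exponent `E U W = Σ_{a∈U} e_{x_a} + Σ_{c∈W} e_{y_c}` (equivalently: `f − g` lies in the span
of the monomials with a squared variable). -/
def PCongr (f g : MvPolynomial (Fin (h + h)) K) : Prop :=
  ∀ U W : Finset (Fin h),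
    coeff (∑ a ∈ U, Finsupp.single (Fin.castAdd h a) 1 + ∑ c ∈ W, Finsupp.single (Fin.natAdd h c) 1) f =
      coeff (∑ a ∈ U, Finsupp.single (Fin.castAdd h a) 1 + ∑ c ∈ W, Finsupp.single (Fin.natAdd h c) 1) g

namespace PCongr

/-- Reflexivity. -/
theorem refl (f : MvPolynomial (Fin (h + h)) K) : PCongr f f := fun _ _ => rfl

/-- Symmetry. -/
theorem symm {f g : MvPolynomial (Fin (h + h)) K} (hfg : PCongr f g) : PCongr g f :=
  fun U W => (hfg U W).symm

/-- Transitivity. -/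
theorem trans {f g k : MvPolynomial (Fin (h + h)) K} (hfg : PCongr f g) (hgk : PCongr g k) : PCongr f k :=
  fun U W => (hfg U W).trans (hgk U W)

/-- Compatibility with sums. -/
theorem add {f f' g g' : MvPolynomial (Fin (h + h)) K} (hf : PCongr f f') (hg : PCongr g g') :
    PCongr (f + g) (f' + g') := fun U W => by
  rw [coeff_add, coeff_add, hf U W, hg U W]

/-- **Compatibility with products** (the convolution formula only involves partition coefficients). -/
theorem mul {f f' g g' : MvPolynomial (Fin (h + h)) K} (hf : PCongr f f') (hg : PCongr g g') :
    PCongr (f * g) (f' * g') := fun U W => by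
  rw [coeff_partitionExpo_mul, coeff_partitionExpo_mul]
  refine Finset.sum_congr rfl fun S _ => Finset.sum_congr rfl fun T _ => ?_
  rw [hf S T, hg (U \ S) (W \ T)]

/-- Compatibility with finite products. -/
theorem prod {ι : Type*} (s : Finset ι) {f g : ι → MvPolynomial (Fin (h + h)) K}
    (hfg : ∀ i ∈ s, PCongr (f i) (g i)) : PCongr (∏ i ∈ s, f i) (∏ i ∈ s, g i) := by
  classical
  induction s using Finset.induction_on with
  | empty => rw [Finset.prod_empty, Finset.prod_empty]; exact PCongr.refl _
  | insert i s hi ih =>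
    rw [Finset.prod_insert hi, Finset.prod_insert hi]
    exact PCongr.mul (hfg i (Finset.mem_insert_self _ _))
      (ih fun j hj => hfg j (Finset.mem_insert_of_mem hj))

/-- `f ≡ g` iff `f − g ≡ 0`. -/
theorem of_sub_zero {f g : MvPolynomial (Fin (h + h)) K} (hfg : PCongr (f - g) 0) : PCongr f g := fun U W => by
  have := hfg U W
  rw [coeff_sub, coeff_zero, sub_eq_zero] at this
  exact this

/-- Congruent polynomials have the same partition matrix on every layout. -/
theorem matrix_eq {r : ℕ} {f g : MvPolynomial (Fin (h + h)) K} (hfg : PCongr f g)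
    (u w : Fin r → Finset (Fin h)) :
    (Matrix.of fun i j : Fin r => coeff (∑ a ∈ u i, Finsupp.single (Fin.castAdd h a) 1 +
        ∑ c ∈ w j, Finsupp.single (Fin.natAdd h c) 1) f) =
      Matrix.of fun i j : Fin r => coeff (∑ a ∈ u i, Finsupp.single (Fin.castAdd h a) 1 +
        ∑ c ∈ w j, Finsupp.single (Fin.natAdd h c) 1) g := by
  ext i j
  rw [Matrix.of_apply, Matrix.of_apply, hfg (u i) (w j)]

end PCongr

/-! ## 2. Invisible monomials and monomial coefficients -/

/-- **A monomial with a squared variable is invisible to partition coefficients:** `coeff (E U W) (X v · (X v · q)) = 0`. -/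
theorem coeff_partitionExpo_X_mul_X_mul (U W : Finset (Fin h)) (v : Fin (h + h))
    (q : MvPolynomial (Fin (h + h)) K) :
    coeff (∑ a ∈ U, Finsupp.single (Fin.castAdd h a) 1 + ∑ c ∈ W, Finsupp.single (Fin.natAdd h c) 1)
      (X v * (X v * q)) = 0 := by
  classical
  rw [coeff_X_mul']
  split_ifs with hv
  · rw [coeff_X_mul', if_neg]
    rw [Finsupp.mem_support_iff, Finsupp.tsub_apply, Finsupp.single_eq_same]
    intro hne
    apply hne
    have hle : ((∑ a ∈ U, Finsupp.single (Fin.castAdd h a) 1 +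
        ∑ c ∈ W, Finsupp.single (Fin.natAdd h c) 1 : Fin (h + h) →₀ ℕ) : Fin (h + h) → ℕ) v ≤ 1 :=
      Summit.ValiantsHypothesis.ValiantsHypothesis.Theorems.BarrierLever.AdditiveDoor.partitionExpo_le_one U W v
    exact Nat.sub_eq_zero_of_le hle
  · rfl

/-- Hence `X v ^ 2 * q ≡ 0`. -/
theorem pcongr_X_sq_mul (v : Fin (h + h)) (q : MvPolynomial (Fin (h + h)) K) :
    PCongr (X v ^ 2 * q) 0 := fun U W => by
  rw [pow_two, mul_assoc, coeff_partitionExpo_X_mul_X_mul, coeff_zero]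

/-- **Coefficient of a partition monomial.** -/
theorem coeff_partitionExpo_monomial (U W S T : Finset (Fin h)) (c : K) :
    coeff (∑ a ∈ U, Finsupp.single (Fin.castAdd h a) 1 + ∑ c ∈ W, Finsupp.single (Fin.natAdd h c) 1)
      (monomial (∑ a ∈ S, Finsupp.single (Fin.castAdd h a) 1 + ∑ c ∈ T, Finsupp.single (Fin.natAdd h c) 1) c) =
      if U = S ∧ W = T then c else 0 := by
  classical
  rw [coeff_monomial]
  by_cases hst : U = S ∧ W = T
  · rw [if_pos hst, if_pos ((partitionExpo_eq_iff S T U W).mpr ⟨hst.1.symm, hst.2.symm⟩)]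
  · rw [if_neg hst, if_neg]
    intro heq
    exact hst (let p := (partitionExpo_eq_iff S T U W).mp heq; ⟨p.1.symm, p.2.symm⟩)

/-- The variable `x_a` is the partition monomial of `({a}, ∅)`. -/
theorem X_castAdd_eq_monomial (a : Fin h) :
    (X (Fin.castAdd h a) : MvPolynomial (Fin (h + h)) K) =
      monomial (∑ a' ∈ ({a} : Finset (Fin h)), Finsupp.single (Fin.castAdd h a') 1 +
        ∑ c ∈ (∅ : Finset (Fin h)), Finsupp.single (Fin.natAdd h c) 1) 1 := by
  rw [Finset.sum_singleton, Finset.sum_empty, add_zero, X, monomial]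

/-- The monomial `y^T` is the partition monomial of `(∅, T)`. -/
theorem prod_X_natAdd_eq_monomial (T : Finset (Fin h)) :
    (∏ c ∈ T, X (Fin.natAdd h c) : MvPolynomial (Fin (h + h)) K) =
      monomial (∑ a ∈ (∅ : Finset (Fin h)), Finsupp.single (Fin.castAdd h a) 1 +
        ∑ c ∈ T, Finsupp.single (Fin.natAdd h c) 1) 1 := by
  simp only [Finset.sum_empty, zero_add, monomial_sum_index, C_1, one_mul]
  rfl

/-! ## 3. The x-gadget group -/

/-- **x-GADGET (G1).** For `a : Fin h`, `T` with `|T| = n ≥ 1`, a primitive `n`-th root of unity `ζ` and `s : K`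
(a `ℂ`-algebra), the group `∏_{k<n} (1 + x_a + ζ^k s Y_T)` has the partition coefficients of
`1 + n·x_a + c·y^T` with `c = −(−s)^n n!` (`ChowFacePrivate.coeff_partitionExpo_rootGroup` with `σ = {a}`). -/
theorem pcongr_xGadget_linear [Algebra ℂ K] {n : ℕ} {ζ : ℂ} (hn : 0 < n) (hζ : IsPrimitiveRoot ζ n)
    (a : Fin h) (T : Finset (Fin h)) (hT : T.card = n) (s : K) :
    PCongr (∏ k ∈ Finset.range n, ((1 + C (1 : K) * ∑ a' ∈ ({a} : Finset (Fin h)), X (Fin.castAdd h a')) +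
        C (algebraMap ℂ K (ζ ^ k) * s) * ∑ c ∈ T, X (Fin.natAdd h c) : MvPolynomial (Fin (h + h)) K))
      (1 + C (n : K) * X (Fin.castAdd h a) +
        C (-((-s) ^ n * (n.factorial : K))) * ∏ c ∈ T, X (Fin.natAdd h c)) := by
  classical
  intro U W
  rw [coeff_partitionExpo_rootGroup hn hζ {a} T hT 1 s U W, coeff_add, coeff_add, coeff_partitionExpo_one K,
    X_castAdd_eq_monomial, prod_X_natAdd_eq_monomial, C_mul_monomial, C_mul_monomial, mul_one, mul_one,
    coeff_partitionExpo_monomial, coeff_partitionExpo_monomial]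
  -- case analysis on `U`, `W`
  by_cases hW : W = ∅
  · subst hW
    by_cases hU : U = ∅
    · subst hU
      have hTne : (∅ : Finset (Fin h)) ≠ T := by
        intro he; rw [← he, Finset.card_empty] at hT; omega
      simp [hTne, Nat.descFactorial_zero]
    · by_cases hUa : U = {a}
      · subst hUa
        have hne : ({a} : Finset (Fin h)) ≠ ∅ := Finset.singleton_ne_empty a
        simp [hne]
      · have hnot : ¬ U ⊆ {a} := by
          intro hsub
          rcases Finset.subset_singleton_iff.mp hsub with h0 | h1
          · exact hU h0
          · exact hUa h1
        simp [hnot, hU, hUa]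
  · by_cases hU : U = ∅
    · subst hU
      by_cases hWT : W = T
      · subst hWT; simp [hW]
      · simp [hW, hWT]
    · have h1 : ¬ (W = ∅ ∧ U ⊆ {a}) := fun hh => hW hh.1
      simp [hW, hU]

/-- `(y^T)² · q ≡ 0` for nonempty `T` (it contains `y_c²` for any `c ∈ T`). -/
theorem pcongr_prodY_sq_mul (T : Finset (Fin h)) (hT : T.Nonempty) (q : MvPolynomial (Fin (h + h)) K) :
    PCongr ((∏ c ∈ T, X (Fin.natAdd h c)) ^ 2 * q) 0 := by
  classical
  obtain ⟨c₀, hc₀⟩ := hT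
  have hsplit : (∏ c ∈ T, X (Fin.natAdd h c) : MvPolynomial (Fin (h + h)) K) =
      X (Fin.natAdd h c₀) * ∏ c ∈ T.erase c₀, X (Fin.natAdd h c) := by
    rw [← Finset.mul_prod_erase T _ hc₀]
  have key : (∏ c ∈ T, X (Fin.natAdd h c)) ^ 2 * q =
      X (Fin.natAdd h c₀) ^ 2 * ((∏ c ∈ T.erase c₀, X (Fin.natAdd h c)) ^ 2 * q) := by
    rw [hsplit]; ring
  rw [key]
  exact pcongr_X_sq_mul _ _

/-- **x-GADGET, factorised form (G1).** With `c = −(−s)^n n!` and `γ = −c·n`: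
`∏_{k<n} (1 + x_a + ζ^k s Y_T) ≡ (1 + c y^T) · (1 + n x_a) · (1 + γ x_a y^T)` — a pure-`y` unit, a pure-`x` unit and the
rank-one factor. -/
theorem pcongr_xGadget [Algebra ℂ K] {n : ℕ} {ζ : ℂ} (hn : 0 < n) (hζ : IsPrimitiveRoot ζ n)
    (a : Fin h) (T : Finset (Fin h)) (hT : T.card = n) (s : K) :
    PCongr (∏ k ∈ Finset.range n, ((1 + C (1 : K) * ∑ a' ∈ ({a} : Finset (Fin h)), X (Fin.castAdd h a')) +
        C (algebraMap ℂ K (ζ ^ k) * s) * ∑ c ∈ T, X (Fin.natAdd h c) : MvPolynomial (Fin (h + h)) K))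
      ((1 + C (-((-s) ^ n * (n.factorial : K))) * ∏ c ∈ T, X (Fin.natAdd h c)) *
        (1 + C (n : K) * X (Fin.castAdd h a)) *
        (1 + C ((-s) ^ n * (n.factorial : K) * (n : K)) * X (Fin.castAdd h a) * ∏ c ∈ T, X (Fin.natAdd h c))) := by
  refine (pcongr_xGadget_linear hn hζ a T hT s).trans (PCongr.symm (PCongr.of_sub_zero ?_))
  have hTne : T.Nonempty := by
    rw [← Finset.card_pos, hT]; exact hn
  -- the difference is a combination of monomials with `x_a²` or `(y^T)²`
  set P : MvPolynomial (Fin (h + h)) K := ∏ c ∈ T, X (Fin.natAdd h c) with hP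
  set x : MvPolynomial (Fin (h + h)) K := X (Fin.castAdd h a) with hx
  set cK : K := -((-s) ^ n * (n.factorial : K)) with hcK
  have hγ : C ((-s) ^ n * (n.factorial : K) * (n : K)) = -(C cK * C (n : K) : MvPolynomial (Fin (h + h)) K) := by
    rw [hcK, ← map_mul, ← map_neg]; congr 1; ring
  have key : (1 + C cK * P) * (1 + C (n : K) * x) * (1 + C ((-s) ^ n * (n.factorial : K) * (n : K)) * x * P) -
      (1 + C (n : K) * x + C cK * P) =
      x ^ 2 * (-(C cK * C (n : K) * C (n : K)) * P * (1 + C cK * P)) +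
        P ^ 2 * (-(C cK * C cK * C (n : K)) * x) := by
    rw [hγ]; ring
  rw [key]
  have h1 := pcongr_X_sq_mul (K := K) (Fin.castAdd h a) (-(C cK * C (n : K) * C (n : K)) * P * (1 + C cK * P))
  have h2 := pcongr_prodY_sq_mul (K := K) T hTne (-(C cK * C cK * C (n : K)) * x)
  have := PCongr.add h1 h2
  rw [add_zero] at this
  exact this

/-! ## 4. The y-single pair form -/

/-- **PAIR FORM (G2).** For `a ≠ a'`: `1 + λ x_a + λ x_{a'} + κ y_c ≡ (1 + λ x_a + λ x_{a'})(1 + κ y_c)(1 − κ χ y_c)`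
with `χ = λ x_a + λ x_{a'} − 2λ² x_a x_{a'}` — a pure-`x` unit, a pure-`y` unit and the factor `1 − κ χ ⊗ y_c`. -/
theorem pcongr_pairForm (a a' c : Fin h) (lam κ : K) :
    PCongr (1 + C lam * X (Fin.castAdd h a) + C lam * X (Fin.castAdd h a') + C κ * X (Fin.natAdd h c) :
        MvPolynomial (Fin (h + h)) K)
      ((1 + C lam * X (Fin.castAdd h a) + C lam * X (Fin.castAdd h a')) * (1 + C κ * X (Fin.natAdd h c)) *
        (1 - C κ * (C lam * X (Fin.castAdd h a) + C lam * X (Fin.castAdd h a') -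
          C (2 * lam ^ 2) * X (Fin.castAdd h a) * X (Fin.castAdd h a')) * X (Fin.natAdd h c))) := by
  refine PCongr.symm (PCongr.of_sub_zero ?_)
  set x := (X (Fin.castAdd h a) : MvPolynomial (Fin (h + h)) K) with hx
  set x' := (X (Fin.castAdd h a') : MvPolynomial (Fin (h + h)) K) with hx'
  set y := (X (Fin.natAdd h c) : MvPolynomial (Fin (h + h)) K) with hy
  have h2 : (C (2 * lam ^ 2) : MvPolynomial (Fin (h + h)) K) = 2 * C lam * C lam := by
    rw [map_mul, map_pow, map_ofNat]; ring
  have key : (1 + C lam * x + C lam * x') * (1 + C κ * y) *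
        (1 - C κ * (C lam * x + C lam * x' - C (2 * lam ^ 2) * x * x') * y) -
      (1 + C lam * x + C lam * x' + C κ * y) =
      x ^ 2 * (C κ * y * (-(C lam * C lam) + 2 * C lam * C lam * C lam * x')) +
        x' ^ 2 * (C κ * y * (-(C lam * C lam) + 2 * C lam * C lam * C lam * x)) +
        y ^ 2 * (-(C κ * C κ) * (C lam * x + C lam * x' - 2 * C lam * C lam * x * x') *
          (1 + C lam * x + C lam * x')) := by
    rw [h2]; ring
  rw [key]
  have hA := pcongr_X_sq_mul (K := K) (Fin.castAdd h a)
    (C κ * y * (-(C lam * C lam) + 2 * C lam * C lam * C lam * x'))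
  have hB := pcongr_X_sq_mul (K := K) (Fin.castAdd h a')
    (C κ * y * (-(C lam * C lam) + 2 * C lam * C lam * C lam * x))
  have hC := pcongr_X_sq_mul (K := K) (Fin.natAdd h c)
    (-(C κ * C κ) * (C lam * x + C lam * x' - 2 * C lam * C lam * x * x') * (1 + C lam * x + C lam * x'))
  have := PCongr.add (PCongr.add hA hB) hC
  rw [add_zero, add_zero] at this
  exact this

end

end Summit.ValiantsHypothesis.ValiantsHypothesis.Theorems.BarrierLever.ChowExactGadgets
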